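import Mathlib
import HarnessLib
import Summits.HubbardSuperconductivity.HubbardSuperconductivity.Theorems.KLProgrammeSectorisedLegKernelsDefs

/-!
# Route `KLProgramme` — ENGINE child gen 8 (stmt-HubbardSuperconductivity-20437 `KLRegimeEngineV17F2`), SKELETON v2 class #3, PROVING side:
# the SCALE ARITHMETIC of the E.5 share in the HYBRID currency (memo HOME/prover-p5/E5-GAIN-SCALE-N.md §12, §17 r17a)
# (cell gate-hubbard-kl, seat p5 g8; the real-number step «(e) slice measure» of the `∃ (C,u), E5ShareStep2 P R C u` recipe)

After `norm_klE5Block_le_of_hybridTails_klAniso` + `klE5_hybridPrefactor_eq` the E.5 block of the step `n−1 → n` is bounded by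
`(4!·13⁴·ε⁻¹)·Σ_s T s`, `T s ≤ ((m₀+m₁+5)!/(4!(1−x′)^{m₀+m₁+6}))·(α·(88δ)²·A_s)` with `m₀ + m₁ = 3` for every colouring (four output legs), where — in the
sizes the suppliers deliver — the derivative line's UNWEIGHTED row sum is `α ≤ Cα·ε⁻¹·16^n/e₀²` (symbol `≍ Λ⁻²` on the shell, `Λ ≥ Λ_n = e₀4^{−n}`), the
soft line's entries are `δ ≤ Cδ·e₀·8^{−n}`, and the enveloped vertex part is `Σ_s A_s ≤ CA·ε²·X·8^n` (`X = c₂c₃·(Klam U)³`-type, level gains included).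
This file is the bookkeeping that these exponents and the ε-powers close EXACTLY on the `E5ShareStep2` target `C·X·2^{−n}` once the slice measure
`Λ_{n−1} − Λ_n = 3e₀4^{−n}` is applied (FINDING (E5-VOL): the old value-form glue left `ε⁻³`; here `ε⁻¹·ε⁻¹·ε² = 1`):

* `klE5_tailConst_le` — `(m₀+m₁+5)!/(4!(1−x′)^{m₀+m₁+6}) ≤ 1680·2⁹` for `m₀ + m₁ = 3`, `0 ≤ x′ ≤ 1/2`;
* `klScale_pred_sub_eq` — `Λ_{n−1} − Λ_n = 3·e₀·(4^n)⁻¹` (`1 ≤ n`);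
* `klE5_scale_arith` — `16^n·((8^n)⁻¹)²·8^n·(4^n)⁻¹ = (2^n)⁻¹`;
* **`klE5_share_arith`** — the assembled inequality: `B ≤ (4!·13⁴·ε⁻¹)·(K·(α·(88δ)²·Atot))` with the three sizes above and `K ≤ 1680·2⁹` gives
  `B·(Λ_{n−1} − Λ_n) ≤ (4!·13⁴·1680·2⁹·88²·3·Cα·Cδ²·CA)·(X·e₀)·(2^n)⁻¹`.

Pure real arithmetic; no definitions, no named facts, nothing about the model; nothing asserts superconductivity.
-/

noncomputable section

namespace Summit.HubbardSuperconductivity.HubbardSuperconductivity.Theorems.KLRegimeSplit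

set_option linter.dupNamespace false -- summit = problem name (single-conjunct summit), D-0017

open Real Finset
open Summit.HubbardSuperconductivity.HubbardSuperconductivity.Theorems.KLProgrammeLegKernels

/-- **The colouring constant is uniform**: with four output legs (`m₀ + m₁ = 3`) and envelope ratio `x′ ≤ 1/2`,
`(m₀+m₁+5)!/(4!·(1−x′)^{m₀+m₁+6}) ≤ 1680·2⁹` (any `x′ ≤ 1/2`). [folklore] -/
theorem klE5_tailConst_le {m₀ m₁ : ℕ} (h : m₀ + m₁ = 3) {x' : ℝ} (hx1 : x' ≤ 1 / 2) :
    ((m₀ + m₁ + 5).factorial : ℝ) / ((4 : ℕ).factorial * (1 - x') ^ (m₀ + m₁ + 6)) ≤ 1680 * 2 ^ 9 := by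
  rw [h]
  have h8 : ((3 + 5).factorial : ℝ) = 40320 := by norm_num [Nat.factorial]
  have h4 : ((4 : ℕ).factorial : ℝ) = 24 := by norm_num [Nat.factorial]
  rw [h8, h4, show (3 + 6 : ℕ) = 9 from rfl]
  have hy : (1 / 2 : ℝ) ≤ 1 - x' := by linarith
  have hy9 : (1 / 2 : ℝ) ^ 9 ≤ (1 - x') ^ 9 := pow_le_pow_left₀ (by norm_num) hy 9
  have hpos : (0 : ℝ) < 24 * (1 - x') ^ 9 := by positivity
  rw [div_le_iff₀ hpos]
  nlinarith [hy9]

/-- **The slice measure**: `Λ_{n−1} − Λ_n = 3·e₀·(4^n)⁻¹` for `1 ≤ n`. [folklore] -/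
theorem klScale_pred_sub_eq (e₀ : ℝ) {n : ℕ} (hn : 1 ≤ n) : klScale e₀ (n - 1) - klScale e₀ n = 3 * e₀ * ((4 : ℝ) ^ n)⁻¹ := by
  obtain ⟨k, rfl⟩ := Nat.exists_eq_add_of_le hn
  rw [show 1 + k - 1 = k from by omega, klScale, klScale, pow_add, pow_one]
  field_simp
  ring

/-- **The exponents close**: `16^n·((8^n)⁻¹)²·8^n·(4^n)⁻¹ = (2^n)⁻¹`. [folklore] -/
theorem klE5_scale_arith (n : ℕ) : (16 : ℝ) ^ n * (((8 : ℝ) ^ n)⁻¹) ^ 2 * (8 : ℝ) ^ n * ((4 : ℝ) ^ n)⁻¹ = ((2 : ℝ) ^ n)⁻¹ := by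
  have h16 : (16 : ℝ) ^ n = (2 : ℝ) ^ n * (8 : ℝ) ^ n := by rw [← mul_pow]; norm_num
  have h4 : (4 : ℝ) ^ n = (2 : ℝ) ^ n * (2 : ℝ) ^ n := by rw [← mul_pow]; norm_num
  rw [h16, h4]
  have h2 : (2 : ℝ) ^ n ≠ 0 := pow_ne_zero _ two_ne_zero
  have h8 : (8 : ℝ) ^ n ≠ 0 := pow_ne_zero _ (by norm_num)
  field_simp

/-- **The E.5 share arithmetic** (step `n−1 → n`, `1 ≤ n`): a block bound `B ≤ (4!·13⁴·ε⁻¹)·(K·(α·(88δ)²·Atot))` with colouring constant `K ≤ 1680·2⁹`,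
derivative-line row sum `α ≤ Cα·ε⁻¹·16^n/e₀²`, soft-line entries `δ ≤ Cδ·e₀·(8^n)⁻¹` and enveloped vertex part `Atot ≤ CA·ε²·X·8^n` gives, against the slice
measure, `B·(Λ_{n−1} − Λ_n) ≤ (4!·13⁴·1680·2⁹·88²·3·Cα·Cδ²·CA)·(X·e₀)·(2^n)⁻¹` — every power of ε cancelled. [folklore] -/
theorem klE5_share_arith {ε e₀ B K α δ Atot Cα Cδ CA X : ℝ} (hε : 0 < ε) (he₀ : 0 < e₀) {n : ℕ} (hn : 1 ≤ n)
    (hK : K ≤ 1680 * 2 ^ 9) (hα0 : 0 ≤ α) (hα : α ≤ Cα * ε⁻¹ * (16 : ℝ) ^ n / e₀ ^ 2)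
    (hδ0 : 0 ≤ δ) (hδ : δ ≤ Cδ * e₀ * ((8 : ℝ) ^ n)⁻¹) (hA0 : 0 ≤ Atot) (hA : Atot ≤ CA * ε ^ 2 * X * (8 : ℝ) ^ n)
    (hB : B ≤ ((4 : ℕ).factorial : ℝ) * 13 ^ 4 * ε⁻¹ * (K * (α * (88 * δ) ^ 2 * Atot))) :
    B * (klScale e₀ (n - 1) - klScale e₀ n) ≤
      (((4 : ℕ).factorial : ℝ) * 13 ^ 4 * (1680 * 2 ^ 9) * 88 ^ 2 * 3 * Cα * Cδ ^ 2 * CA) * (X * e₀) * ((2 : ℝ) ^ n)⁻¹ := by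
  have hslice := klScale_pred_sub_eq e₀ hn
  have hslice0 : 0 ≤ klScale e₀ (n - 1) - klScale e₀ n := by rw [hslice]; positivity
  have hCα : 0 ≤ Cα := by
    by_contra hneg
    have hneg : Cα < 0 := not_le.mp hneg
    have : Cα * ε⁻¹ * (16 : ℝ) ^ n / e₀ ^ 2 < 0 := by
      have h1 : 0 < ε⁻¹ * (16 : ℝ) ^ n / e₀ ^ 2 := by positivity
      have h2 : Cα * ε⁻¹ * (16 : ℝ) ^ n / e₀ ^ 2 = Cα * (ε⁻¹ * (16 : ℝ) ^ n / e₀ ^ 2) := by ring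
      rw [h2]; exact mul_neg_of_neg_of_pos hneg h1
    linarith
  have hCδ : 0 ≤ Cδ * e₀ * ((8 : ℝ) ^ n)⁻¹ := hδ0.trans hδ
  -- bound each factor
  have h1 : α * (88 * δ) ^ 2 * Atot ≤ (Cα * ε⁻¹ * (16 : ℝ) ^ n / e₀ ^ 2) * (88 * (Cδ * e₀ * ((8 : ℝ) ^ n)⁻¹)) ^ 2 * (CA * ε ^ 2 * X * (8 : ℝ) ^ n) := by
    have hsq : (88 * δ) ^ 2 ≤ (88 * (Cδ * e₀ * ((8 : ℝ) ^ n)⁻¹)) ^ 2 :=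
      pow_le_pow_left₀ (by positivity) (mul_le_mul_of_nonneg_left hδ (by norm_num)) 2
    exact mul_le_mul (mul_le_mul hα hsq (by positivity) (hα0.trans hα)) hA hA0 (by positivity)
  have h2 : K * (α * (88 * δ) ^ 2 * Atot) ≤
      (1680 * 2 ^ 9) * ((Cα * ε⁻¹ * (16 : ℝ) ^ n / e₀ ^ 2) * (88 * (Cδ * e₀ * ((8 : ℝ) ^ n)⁻¹)) ^ 2 * (CA * ε ^ 2 * X * (8 : ℝ) ^ n)) :=
    mul_le_mul hK h1 (by positivity) (by positivity)
  have hpre : (0 : ℝ) ≤ ((4 : ℕ).factorial : ℝ) * 13 ^ 4 * ε⁻¹ := by positivity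
  have h3 := (hB.trans (mul_le_mul_of_nonneg_left h2 hpre))
  refine (mul_le_mul_of_nonneg_right h3 hslice0).trans (le_of_eq ?_)
  rw [hslice]
  have hε' : ε ≠ 0 := hε.ne'
  have he' : e₀ ≠ 0 := he₀.ne'
  have h8 : (8 : ℝ) ^ n ≠ 0 := pow_ne_zero _ (by norm_num)
  have h2' : (2 : ℝ) ^ n ≠ 0 := pow_ne_zero _ two_ne_zero
  -- normalise: split `16^n = 2^n·8^n`, `4^n = 2^n·2^n`, clear denominators
  have h16 : (16 : ℝ) ^ n = (2 : ℝ) ^ n * (8 : ℝ) ^ n := by rw [← mul_pow]; norm_num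
  have h4' : (4 : ℝ) ^ n = (2 : ℝ) ^ n * (2 : ℝ) ^ n := by rw [← mul_pow]; norm_num
  rw [h16, h4']
  field_simp

end Summit.HubbardSuperconductivity.HubbardSuperconductivity.Theorems.KLRegimeSplit

end
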